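import Literature.Geometry.Manifold.QuotientManifold

/-!
# Descent of `C^n` maps to quotient manifolds, and maps between quotients

Complements to `Literature/Geometry/Manifold/QuotientManifold.lean` (the `C^n` structure on the
orbit space `M/G` of a free, properly discontinuous action by `C^n` maps, the projection
`mk : M → M/G` a `C^n` local diffeomorphism). For such an action:

* `localSection p` — a name for Mathlib's local inverse of `mk` at `p` (the local section
  `σ_p : M/G → M` through `p`; the charts of `M/G` are `σ_p ≫ chartAt H p`), with its basic API
  and `contMDiffAt_localSection` (repackaging `contMDiffOn_localInverseAt`);
* **descent** (`contMDiffAt_comp_mk_iff`, `contMDiff_comp_mk_iff`, `mdifferentiable_comp_mk_iff`):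
  a map `f : M/G → N` into any charted space is `C^n` (resp. differentiable) iff `f ∘ mk` is;
  hence `C^n` maps `M/G → N` "are" the `G`-invariant `C^n` maps `M → N`
  (`invariantEquiv`, `contMDiff_invariantEquiv_iff`);
* **maps of quotients over `M`** (`contMDiff_of_comp_mk_eq`, `isLocalDiffeomorph_of_comp_mk_eq`):
  for two such actions of `G₁` and `G` on the same `M`, any map `f : M/G₁ → M/G` with
  `f ∘ mk = mk` (e.g. the one induced by `G₁ ≤ G`) is a `C^n` local diffeomorphism.

Source: standard (J. M. Lee, *Introduction to Smooth Manifolds*, 2nd ed., Thm 4.29 (maps from a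
quotient by a smooth covering / submersion are smooth iff the composite is) and Ch. 21); tagged
folklore. Ported from the Hodge–Picard-modular adjudication package (`HodgeCM/PerL34/
QuotientHolomorphic.lean`, `QuotientFunctions.lean`, 2026-08-18), re-based on this directory's API.
Not here: deck transformations and quotients in stages (`QuotientDeck.lean`).
-/

open scoped Manifold ContDiff Topology
open Set Function MulAction

noncomputable section

namespace Literature.Geometry.Manifold

namespace QuotientManifold

section Invariant

variable (G : Type*) [Group G] (M : Type*) [MulAction G M] (N : Type*)

/-- `G`-invariant functions `M → N` ARE functions `M/G → N` (`Quotient.lift`; no topology).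
[folklore] -/
def invariantEquiv :
    {F : M → N // ∀ g : G, ∀ x : M, F (g • x) = F x} ≃ (orbitRel.Quotient G M → N) where
  toFun F := Quotient.lift F.1 fun a b (h : a ∈ orbit G b) => by
    obtain ⟨g, rfl⟩ := h
    exact F.2 g b
  invFun f := ⟨f ∘ Quotient.mk (orbitRel G M), fun g x =>
    congrArg f (Quotient.sound (mem_orbit x g : g • x ∈ orbit G x))⟩
  left_inv F := by ext x; rfl
  right_inv f := by
    funext q
    obtain ⟨p, rfl⟩ := Quotient.mk_surjective (s := orbitRel G M) q
    rfl

variable {G M N} in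
/-- The descended function of an invariant `F` takes the value `F p` on the orbit of `p`.
[folklore] -/
@[simp] theorem invariantEquiv_apply_mk
    (F : {F : M → N // ∀ g : G, ∀ x : M, F (g • x) = F x}) (p : M) :
    invariantEquiv G M N F (Quotient.mk (orbitRel G M) p) = F.1 p := rfl

variable {G M N} in
/-- The descended function of an invariant `F`, composed with the projection, is `F`.
[folklore] -/
theorem invariantEquiv_comp_mk (F : {F : M → N // ∀ g : G, ∀ x : M, F (g • x) = F x}) :
    invariantEquiv G M N F ∘ Quotient.mk (orbitRel G M) = F.1 := rfl

end Invariant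

variable {𝕜 : Type*} [NontriviallyNormedField 𝕜] {E : Type*} [NormedAddCommGroup E]
  [NormedSpace 𝕜 E] {H : Type*} [TopologicalSpace H] {I : ModelWithCorners 𝕜 E H} {n : ℕ∞ω}
  {G : Type*} [Group G] {M : Type*} [TopologicalSpace M] [MulAction G M]
  [ProperlyDiscontinuousSMul G M] [ContinuousConstSMul G M] [IsCancelSMul G M] [T2Space M]
  [LocallyCompactSpace M]

/-! ## Local sections of the projection -/

/-- The local section `σ_p : M/G → M` of the projection through `p`: Mathlib's local inverse
`IsLocalHomeomorph.localInverseAt` of `mk` at `p` (an open partial homeomorphism with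
`σ_p.symm = mk`, `p ∈ σ_p.target`; the charts of `M/G` are `σ_p ≫ chartAt H p`). [folklore] -/
abbrev localSection (p : M) : OpenPartialHomeomorph (orbitRel.Quotient G M) M :=
  (isLocalHomeomorph_mk (G := G) (M := M)).localInverseAt p

/-- `mk p` lies in the source of the local section through `p`. [folklore] -/
theorem mk_mem_localSection_source (p : M) :
    mk (G := G) p ∈ (localSection (G := G) p).source :=
  (isLocalHomeomorph_mk (G := G) (M := M)).apply_self_mem_localInverseAt_source

/-- `p` lies in the target of the local section through `p`. [folklore] -/
theorem mem_localSection_target (p : M) : p ∈ (localSection (G := G) p).target :=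
  (isLocalHomeomorph_mk (G := G) (M := M)).self_mem_localInverseAt_target

/-- The local section through `p` sends the orbit of `p` to `p`. [folklore] -/
@[simp] theorem localSection_apply_mk (p : M) : localSection (G := G) p (mk p) = p :=
  (isLocalHomeomorph_mk (G := G) (M := M)).localInverseAt_apply_self

/-- The inverse of a local section is (a restriction of) the projection. [folklore] -/
theorem localSection_symm_eq (p : M) :
    ((localSection (G := G) p).symm : M → orbitRel.Quotient G M) = mk :=
  (isLocalHomeomorph_mk (G := G) (M := M)).localInverseAt_symm p

/-- The inverse of a local section is (a restriction of) the projection, pointwise. [folklore] -/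
@[simp] theorem localSection_symm_apply (p z : M) : (localSection (G := G) p).symm z = mk z :=
  congrFun (localSection_symm_eq p) z

/-- A local section is a section of the projection on its source. [folklore] -/
theorem mk_localSection_apply (p : M) {q : orbitRel.Quotient G M}
    (hq : q ∈ (localSection (G := G) p).source) : mk (localSection (G := G) p q) = q :=
  mk_localInverseAt hq

variable [ChartedSpace H M]

section Smooth

variable [IsManifold I n M]

/-- The local sections of the projection are `C^n` at every point of their sources
(`contMDiffOn_localInverseAt`, pointwise form). [folklore] -/
theorem contMDiffAt_localSection (hsmooth : ∀ g : G, ContMDiff I I n (fun x : M => g • x))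
    (p : M) {q : orbitRel.Quotient G M} (hq : q ∈ (localSection (G := G) p).source) :
    ContMDiffAt I I n (localSection (G := G) p) q :=
  (contMDiffOn_localInverseAt hsmooth p q hq).contMDiffAt
    ((localSection (G := G) p).open_source.mem_nhds hq)

/-! ## Descent of regularity along the projection -/

variable {E' : Type*} [NormedAddCommGroup E'] [NormedSpace 𝕜 E'] {H' : Type*} [TopologicalSpace H']
  {J : ModelWithCorners 𝕜 E' H'} {N : Type*} [TopologicalSpace N] [ChartedSpace H' N]

/-- **Descent of regularity**: `f : M/G → N` is `C^n` at `mk p` iff `f ∘ mk` is `C^n` at `p`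
(near `mk p`, `f = (f ∘ mk) ∘ σ_p` with `σ_p` a `C^n` local section). [folklore] -/
theorem contMDiffAt_comp_mk_iff (hsmooth : ∀ g : G, ContMDiff I I n (fun x : M => g • x))
    {f : orbitRel.Quotient G M → N} (p : M) :
    ContMDiffAt I J n (f ∘ mk (G := G)) p ↔ ContMDiffAt I J n f (mk (G := G) p) := by
  constructor
  · intro h
    have h1 : ContMDiffAt I I n (localSection (G := G) p) (mk p) :=
      contMDiffAt_localSection hsmooth p (mk_mem_localSection_source p)
    have h2 : ContMDiffAt I J n (f ∘ mk (G := G)) (localSection (G := G) p (mk p)) := by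
      rwa [localSection_apply_mk]
    refine (h2.comp _ h1).congr_of_eventuallyEq ?_
    filter_upwards [(localSection (G := G) p).open_source.mem_nhds (mk_mem_localSection_source p)]
      with q hq
    simp only [Function.comp_apply, mk_localSection_apply p hq]
  · intro h
    exact h.comp p (contMDiff_mk hsmooth p)

/-- **`f : M/G → N` is `C^n` iff `f ∘ mk : M → N` is.** [folklore] -/
theorem contMDiff_comp_mk_iff (hsmooth : ∀ g : G, ContMDiff I I n (fun x : M => g • x))
    {f : orbitRel.Quotient G M → N} :
    ContMDiff I J n (f ∘ mk (G := G)) ↔ ContMDiff I J n f := by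
  constructor
  · intro h q
    obtain ⟨p, rfl⟩ := Quotient.mk_surjective (s := orbitRel G M) q
    exact (contMDiffAt_comp_mk_iff hsmooth p).mp (h p)
  · intro h p
    exact (contMDiffAt_comp_mk_iff hsmooth p).mpr (h _)

/-- Differentiable version of descent at a point (`n ≠ 0`): `f` is differentiable at `mk p` iff
`f ∘ mk` is differentiable at `p`. [folklore] -/
theorem mdifferentiableAt_comp_mk_iff (hsmooth : ∀ g : G, ContMDiff I I n (fun x : M => g • x))
    (hn : n ≠ 0) {f : orbitRel.Quotient G M → N} (p : M) :
    MDifferentiableAt I J (f ∘ mk (G := G)) p ↔ MDifferentiableAt I J f (mk (G := G) p) := by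
  constructor
  · intro h
    have h1 : MDifferentiableAt I I (localSection (G := G) p) (mk p) :=
      (contMDiffAt_localSection hsmooth p (mk_mem_localSection_source p)).mdifferentiableAt hn
    have h2 : MDifferentiableAt I J (f ∘ mk (G := G)) (localSection (G := G) p (mk p)) := by
      rwa [localSection_apply_mk]
    refine (h2.comp _ h1).congr_of_eventuallyEq ?_
    filter_upwards [(localSection (G := G) p).open_source.mem_nhds (mk_mem_localSection_source p)]
      with q hq
    simp only [Function.comp_apply, mk_localSection_apply p hq]
  · intro h
    exact h.comp p ((contMDiff_mk hsmooth p).mdifferentiableAt hn)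

/-- **`f : M/G → N` is differentiable iff `f ∘ mk` is** (`n ≠ 0`). [folklore] -/
theorem mdifferentiable_comp_mk_iff (hsmooth : ∀ g : G, ContMDiff I I n (fun x : M => g • x))
    (hn : n ≠ 0) {f : orbitRel.Quotient G M → N} :
    MDifferentiable I J (f ∘ mk (G := G)) ↔ MDifferentiable I J f := by
  constructor
  · intro h q
    obtain ⟨p, rfl⟩ := Quotient.mk_surjective (s := orbitRel G M) q
    exact (mdifferentiableAt_comp_mk_iff hsmooth hn p).mp (h p)
  · intro h p
    exact (mdifferentiableAt_comp_mk_iff hsmooth hn p).mpr (h _)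

/-- **`C^n` maps `M/G → N` = `G`-invariant `C^n` maps `M → N`**: under `invariantEquiv`, an
invariant `F` is `C^n` iff its descent is. [folklore] -/
theorem contMDiff_invariantEquiv_iff (hsmooth : ∀ g : G, ContMDiff I I n (fun x : M => g • x))
    (F : {F : M → N // ∀ g : G, ∀ x : M, F (g • x) = F x}) :
    ContMDiff I J n (invariantEquiv G M N F) ↔ ContMDiff I J n F.1 := by
  rw [← contMDiff_comp_mk_iff (G := G) hsmooth, invariantEquiv_comp_mk]

/-- Differentiable version (`n ≠ 0`): the descent of an invariant `F` is differentiable iff `F`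
is. [folklore] -/
theorem mdifferentiable_invariantEquiv_iff
    (hsmooth : ∀ g : G, ContMDiff I I n (fun x : M => g • x)) (hn : n ≠ 0)
    (F : {F : M → N // ∀ g : G, ∀ x : M, F (g • x) = F x}) :
    MDifferentiable I J (invariantEquiv G M N F) ↔ MDifferentiable I J F.1 := by
  rw [← mdifferentiable_comp_mk_iff (G := G) hsmooth hn, invariantEquiv_comp_mk]

/-! ## Maps `M/G₁ → M/G` over `M` -/

variable {G₁ : Type*} [Group G₁] [MulAction G₁ M] [ProperlyDiscontinuousSMul G₁ M]
  [ContinuousConstSMul G₁ M] [IsCancelSMul G₁ M]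

/-- **A map of quotients `f : M/G₁ → M/G` over `M`** (`f ∘ mk = mk`; e.g. the map induced by
`G₁ ≤ G`) **is `C^n`** — by descent, since `f ∘ mk = mk` is. [folklore] -/
theorem contMDiff_of_comp_mk_eq (h₁ : ∀ g : G₁, ContMDiff I I n (fun x : M => g • x))
    (h : ∀ g : G, ContMDiff I I n (fun x : M => g • x))
    (f : orbitRel.Quotient G₁ M → orbitRel.Quotient G M) (hf : ∀ z : M, f (mk z) = mk z) :
    ContMDiff I I n f :=
  (contMDiff_comp_mk_iff (G := G₁) h₁).mp ((contMDiff_mk h).congr fun z => hf z)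

/-- The local model `σ¹_p ≫ mk` near `mk p` of a map of quotients `M/G₁ → M/G` over `M`, as a
partial diffeomorphism. [folklore] -/
def overPartialDiffeomorph (h₁ : ∀ g : G₁, ContMDiff I I n (fun x : M => g • x))
    (h : ∀ g : G, ContMDiff I I n (fun x : M => g • x)) (p : M) :
    PartialDiffeomorph I I (orbitRel.Quotient G₁ M) (orbitRel.Quotient G M) n where
  toPartialEquiv :=
    ((localSection (G := G₁) p).trans (localSection (G := G) p).symm).toPartialEquiv
  open_source := ((localSection (G := G₁) p).trans (localSection (G := G) p).symm).open_source
  open_target := ((localSection (G := G₁) p).trans (localSection (G := G) p).symm).open_target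
  contMDiffOn_toFun := by
    change ContMDiffOn I I n ((localSection (G := G₁) p).trans (localSection (G := G) p).symm)
      ((localSection (G := G₁) p).trans (localSection (G := G) p).symm).source
    rw [OpenPartialHomeomorph.trans_source, OpenPartialHomeomorph.coe_trans, localSection_symm_eq]
    exact (contMDiff_mk h).comp_contMDiffOn
      ((contMDiffOn_localInverseAt h₁ p).mono inter_subset_left)
  contMDiffOn_invFun := by
    change ContMDiffOn I I n ((localSection (G := G₁) p).trans (localSection (G := G) p).symm).symm
      ((localSection (G := G₁) p).trans (localSection (G := G) p).symm).target
    rw [← OpenPartialHomeomorph.symm_source, OpenPartialHomeomorph.trans_symm_eq_symm_trans_symm,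
      OpenPartialHomeomorph.symm_symm, OpenPartialHomeomorph.trans_source,
      OpenPartialHomeomorph.coe_trans, localSection_symm_eq]
    exact (contMDiff_mk h₁).comp_contMDiffOn
      ((contMDiffOn_localInverseAt h p).mono inter_subset_left)

/-- **A map of quotients `f : M/G₁ → M/G` over `M` is a `C^n` local diffeomorphism.**
[folklore] -/
theorem isLocalDiffeomorph_of_comp_mk_eq (h₁ : ∀ g : G₁, ContMDiff I I n (fun x : M => g • x))
    (h : ∀ g : G, ContMDiff I I n (fun x : M => g • x))
    (f : orbitRel.Quotient G₁ M → orbitRel.Quotient G M) (hf : ∀ z : M, f (mk z) = mk z) :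
    IsLocalDiffeomorph I I n f := by
  intro q₁
  obtain ⟨p, rfl⟩ := Quotient.mk_surjective (s := orbitRel G₁ M) q₁
  refine ⟨overPartialDiffeomorph h₁ h p, ?_, ?_⟩
  · change mk p ∈ ((localSection (G := G₁) p).trans (localSection (G := G) p).symm).source
    rw [OpenPartialHomeomorph.trans_source]
    refine ⟨mk_mem_localSection_source p, ?_⟩
    rw [mem_preimage, OpenPartialHomeomorph.symm_source, localSection_apply_mk]
    exact mem_localSection_target p
  · intro q hq
    change q ∈ ((localSection (G := G₁) p).trans (localSection (G := G) p).symm).source at hq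
    change f q = ((localSection (G := G₁) p).trans (localSection (G := G) p).symm) q
    rw [OpenPartialHomeomorph.trans_source] at hq
    have hq1 : q ∈ (localSection (G := G₁) p).source := hq.1
    rw [OpenPartialHomeomorph.trans_apply, localSection_symm_apply, ← hf,
      mk_localSection_apply p hq1]

end Smooth

end QuotientManifold

end Literature.Geometry.Manifold
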